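import Summits.BirchSwinnertonDyer.Rank1Residual.Additive.N10LowerHalfStatements
import HarnessLib
import HarnessLib.Audit.Tags

/-!
# Class N10 of the residual map — the LOWER half at an additive, potentially ordinary prime, rank `0`:
# OBSTRUCTION ANATOMY → SUB-PARTITION, TRANSPORT, the binder-by-binder comparison with the kernel's
# residue theorems, and what the conjectures buy (cell `b2b-bsdres`, lane CLASS-CLOSURE, seat cc-typer-2,
# team n1011 sub-target T-N10; sibling of `Additive/N10LowerHalfStatements.lean`)

HONEST FRAMING (cell `b2b-bsdres`, run/shared/lean/b2b/bsd-rank1-residual/, verbatim in every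
file): the goal of the cell is to DELETE the COMBINATION-SHAPED residual classes of the
Birch–Swinnerton-Dyer formula for ALL analytic-rank `≤ 1` elliptic curves over `ℚ` — "full BSD
formula for every rank `≤ 1` curve in class `C`" assembled STRICTLY from published theorems — so
that the rank-`≤ 1` remainder becomes exactly the CONSTRUCTION-SHAPED classes, which are TYPED
(missing-input `Prop`s), NOT attempted. This is not "finishing BSD". Lane CLASS-CLOSURE
(coordinator ruling 2026-08-21T04:07Z): research routes, no claim beyond the stated classes;
census output = EVIDENCE / conjecture items with held-out validation, NEVER a Literature fact;
nothing below is a theorem about elliptic curves beyond bookkeeping against the kernel; the class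
N10 stays CONSTRUCTION-shaped (RESIDUAL-MAP §I, SIGNED 2026-08-21T02:29Z); NOTHING is booked.

Definitions (`Prop`-valued predicates and `@[conjecture]` statements, nothing asserted) and
bookkeeping theorems only; no named fact is minted; every published input of every consequence is
an explicit named-fact binder of the tree (referee-1 rule R1).

The conjectures themselves (`N10.LowerHalf`, `N10.LowerHalfM`, `N10.LowerHalfGordTwo`,
`N10.LowerHalfGordHigher`), the locus / cell predicates and the EVIDENCE paragraph are in the sibling
file `Additive/N10LowerHalfStatements.lean`. This file: (b) the sub-partition VERDICT (module docstring
table + §3 theorems), (c) the transport notes, §3 the comparison with the kernel's LOWER conjuncts, §4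
the consumers.

## (b) OBSTRUCTION ANATOMY → SUB-PARTITION (cell predicates `N10.Cell*` in the sibling's §1; verdict table here; R4/R6 honest notes)

The neighbouring PUBLISHED proofs of a main-conjecture LOWER bound, the hypothesis that fails on
N10, and on how much of the locus (every failure is BY CONSTRUCTION, on 100 % of the named cell —
no census is needed to see it; the census columns of CLASS-CLOSURE-PLAN §3.2 E2 refine only the
per-pair instruments):

| neighbouring proof (LOWER direction) | needs | fails on N10 because | cell | verbatim-extension sub-class |
|---|---|---|---|---|
| Skinner–Urban 2014 Thm. 3.6.4 on `f_E` (`Literature/…/SkinnerUrban2014/GL2MainConjecture`) | (ord) `a_p(f) ∈ ℤ_pˣ`, `p ∤ N_f` | additive ⇒ `a_p(E) = 0`, `p² ∣ N` | all | ∅ |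
| Skinner–Urban 2014 Cor. 3.6.3 / Thm. 3.6.4 on the twist `f_{E♭}`, `E = E♭ ⊗ χ_{p*}` (`e = 2`) | reaches `L(E,1) = L(E♭, χ_{p*}, 1)` only through the branch `χ = ω^{k−2}χ₁`, `χ₁` of `p`-power order (p. 42) | `χ_{p*} = ω^{(p−1)/2}` has order `2`, prime to `p` | (M), (G-ord, `e = 2`) | ∅ (gives `BSD_p(E♭)`, the CLOSED partner, not `E`) |
| Skinner–Urban 2014 Thm. 3.6.1/3.6.6 over an imaginary quadratic `K` | `p` split in `K` | the field carrying `E ↦ E♭` is `K = ℚ(√p*)`, `p` RAMIFIED | (M), (G-ord, `e = 2`) | ∅ |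
| Wan 2015 (Hilbert modular, `Literature/…/Wan2015/`) over the semistabilising field `F` | `p` unramified in `F` | `F ∋ √p*` resp. `F ⊂ ℚ(μ_p)`: `p` totally ramified | all | ∅ |
| Greenberg–Vatsal 2000 (reducible `E[p]`, X3 rows) | GOOD ORDINARY reduction at `p` | additive; on `E♭` it gives the trivial branch only | X3 ∩ N10 | ∅ |
| Kim 2026 Thm. 1.10 (1) ⟺ Kato's IMC (`X4/KuriharaClasswide`: `KuriharaUnitAt`) | `p ≥ 5`, `ρ̄` onto, Manin, `p ∤ ∏ c_ℓ` | nothing fails — but it is an EQUIVALENCE with the open IMC, i.e. a per-pair CERTIFICATE route | X4 ∧ surj ∧ `p ≥ 5` | per pair: `X4.bsdp_of_kuriharaUnitAt_of_analyticRank_eq_zero` (tree) |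
| `p`-descent + Cassels–Tate (`Typed/CasselsLowerBound`: `missingLowerBoundAt_of_casselsTate_of_pow_dvd`) | a descent certificate `p^{ord_p #Ш_an} ∣ #Ш` | nothing — per-pair instrument (I-11) | all | per pair (the 49 rows above) |

VERDICT (b): at CLASS level the verbatim-extension sub-class of N10 is EMPTY for every printed
lower-bound proof — each fails one hypothesis by construction on the whole cell; the provers'
near-verbatim statements are the two PER-PAIR routes already in the tree (last two rows; not
restated here, R1). The IRREDUCIBLE RESIDUE, named for ideation: on (M) ∪ (G-ord, `e = 2`) —
**the Greenberg–Iwasawa main-conjecture LOWER bound `char_Λ X ⊆ (L_p)` on the quadratic branch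
`ω^{(p−1)/2}` of the cyclotomic Iwasawa theory of a `p`-ORDINARY (good, resp. multiplicative)
weight-2 newform `f♭` of level prime to `p` (resp. `p ‖ N`)** — the statement whose UPPER twin is
the tree's reading-fact `Kato2004.charIdeal_dvd_padicLFunctionBranch_component_of_surjective` with
the divisibility reversed; equivalently the cyclotomic IMC lower bound for `E♭` over `K = ℚ(√p*)`
at the prime RAMIFIED in `K` (kernel currency: `AdditivePotMult.MissingLowerBoundOverCAt
(W.baseChange K) p`, "printed nowhere" — `AdditivePotMult/ModelFreeClassTheorems`). On (G-ord,
`e ∈ {3,4,6}`) (`p ∈ {5, 7, 13}` only): the same lower bound for Delbourgo's (G)-Selmer group /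
the `p`-new nebentypus form `f̃ ∈ S₂(Ñ, ε²)` (no twist curve over `ℚ`), PLUS — on its `Red ∨ ¬Surj`
rows only (425 S-b pairs) — the Kato-direction input `CycLeadingTermAt W p`
(`Additive/GordCycLeadingTerm`, located gap there).

## (c) TRANSPORT (comparison statements; printed antecedents; what the kernel already has)

* Isogeny (Cassels 1965 / tree `GordIsogenyInvariance*`): `BSD_p` is isogeny-invariant — in kernel;
  no N10 pair leaves its cell under isogeny (the cells are defined by `ord_p j` and the reduction type, both isogeny-invariant).
* Quadratic twist / base change on (M) ∪ (G-ord, `e = 2`) — IN KERNEL, both directions: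
  `AdditivePotMult.missingPPartOverCAt_baseChange_iff_bsdp` (Milne 1972 Thm. 1 via
  Dokchitser–Dokchitser 2010 §2.1, `hMilneC`): given `BSD_p` of the semistable twist `E^{(d_K)}`
  (a CLOSED X11a/(ram) or good-ordinary S–U/Kato pair), `BSD_p(E) ⟺ MissingPPartOverCAt
  (W.baseChange K) p`, and ONE inequality suffices on X4 (`…_of_lowerOverC_of_kim`,
  `GordDescentModelFreeCases.bsdp_iff_lowerOverC_of_classX4Gord_two_of_kim`). HONEST NOTE
  (CLASS-CLOSURE-PLAN §3.1 E3, reproduced per referee-1 R4): `L(E,1)` and `L(E♭,1)` are values of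
  `E♭`'s measure at DIFFERENT characters (the `ε`-branch), so twist data is data for this comparison
  statement, not a lemma by itself; the kernel's twist route transports the UPPER half only — the
  lower half over `K` is the residue named in (b). The `p = 3` pair-level version of this transport
  is team n1011's sub-target T-c1 (seat n1011-p08), not this file.
* Level-lowering congruences (Greenberg–Vatsal `μ/λ` transport to a congruent CLOSED curve): needs
  GOOD ORDINARY reduction at `p` on both sides (GV 2000 / EPW 2006 Thm. 1) — fails at an additive
  `p`; on the twist `E♭` it is again the trivial branch. Candidate lemma only if an `ω^a`-branch
  version of EPW's `λ/μ`-invariance is sourced — none found (presearch line in the seat's NOTES).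

References: RESIDUAL-MAP.md §I N10, §D, §E (cell HOME); CLASS-CLOSURE-PLAN.md §3.2; D. Delbourgo,
Compositio Math. 113 (1998) Prop. 4 (p. 144), Main Conjecture (p. 151) [Delbourgo1998]; C. Skinner,
E. Urban, Invent. Math. 195 (2014) Cor. 3.6.2–3.6.3 (p. 42), Thm. 3.6.4 (p. 43) [SkinnerUrban2014];
X. Wan, Algebra Number Theory 9 (2015) [Wan2015HilbertIMC]; R. Greenberg, V. Vatsal, Invent. Math. 142
(2000) [GreenbergVatsal2000]; K. Kato, Astérisque 295 (2004) Thm. 14.5 (3), Thm. 17.4 (3)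
[Kato2004Asterisque]; C. Wuthrich, Doc. Math. 19 (2014) Thm. 16, Lemma 20 [Wuthrich2014]; C.-H. Kim,
Amer. J. Math. 148 (2026) Thm. 1.8, Thm. 1.10, Conj. 1.10 [Kim2022StructureSelmer]; J. S. Milne,
Invent. Math. 17 (1972) Thm. 1 [Milne1972ArithmeticAV]; R. L. Miller, LMS J. Comput. Math. 14 (2011) Def. 1.1
[Miller2011LMS].
-/

noncomputable section

open scoped Classical

open WeierstrassCurve Literature.NumberTheory.EllipticCurves
  Literature.NumberTheory.EllipticCurves.ModularForms
  Literature.NumberTheory.EllipticCurves.Rank1Residual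
  Literature.NumberTheory.EllipticCurves.Rank1Residual.Typed

namespace Summit.BirchSwinnertonDyer.Rank1Residual.Additive

/-! ## §3 Binder-by-binder comparison with the kernel's residue theorems (referee-1 R3-type check)

The LOWER conjunct of `x3Sharp_iff_residues` (X3 end-state, p246661) is
`∀ W p, r_an = 0 → p ≠ 2 → ClassX3 W p → SubSemistableTwist W p → MissingLowerBoundAt W p`;
the LOWER conjunct of `x4SharpUnitFree_iff_lower_and_residues_sharp` (X4 end-state, p246578) is
`∀ W p, r_an = 0 → ClassX4 W p → Surj W p → MissingLowerBoundAt W p`. Below: the reducible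
(X3) part of `N10.LowerHalf` is EXACTLY the X3 LOWER conjunct together with the lower half on the
reducible corner rows (which the tree's `X3SharpGordHigher` implies); the irreducible-surjective part of
`N10.LowerHalf` is implied by the X4 LOWER conjunct (whose potentially supersingular remainder is
O5/O6's); the irreducible NON-surjective part of N10 (O8 ∩ potentially ordinary) is named separately. -/

/-- The reducible (class-X3) part of `N10.LowerHalf` (open sub-conjecture; nothing asserted). [folklore] -/
@[conjecture] def N10.LowerHalfRed : Prop :=
  ∀ (W : WeierstrassCurve ℚ) [W.IsElliptic] [W.IsGloballyMinimal] (p : ℕ) [Fact p.Prime],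
    W.analyticRank = 0 → N10.Locus W p → Red W p → MissingLowerBoundAt W p

/-- The irreducible-and-surjective (class-X4 ∧ surj) part of `N10.LowerHalf` (open sub-conjecture;
nothing asserted). [folklore] -/
@[conjecture] def N10.LowerHalfSurj : Prop :=
  ∀ (W : WeierstrassCurve ℚ) [W.IsElliptic] [W.IsGloballyMinimal] (p : ℕ) [Fact p.Prime],
    W.analyticRank = 0 → N10.Locus W p → Surj W p → MissingLowerBoundAt W p

/-- The irreducible-but-NOT-surjective part of `N10.LowerHalf` (images 3Nn/3Ns/5Ns/5Nn/5S4/7Ns/13S4 at a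
potentially ordinary additive prime — these rows are ALSO in class O8 of the map; no printed
statement reaches them; open sub-conjecture, nothing asserted). [folklore] -/
@[conjecture] def N10.LowerHalfNonSurj : Prop :=
  ∀ (W : WeierstrassCurve ℚ) [W.IsElliptic] [W.IsGloballyMinimal] (p : ℕ) [Fact p.Prime],
    W.analyticRank = 0 → N10.Locus W p → Irr W p → ¬ Surj W p → MissingLowerBoundAt W p

/-- **N10 splits by image as reducible ∧ surjective ∧ (irreducible non-surjective)** — every pair is in
exactly one part (`Red = ¬ Irr`; a surjective `ρ̄` is irreducible: `hasIrreducibleModPGaloisRep_of_hasSurjectiveModNGaloisRep`).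
[folklore] -/
theorem N10.lowerHalf_iff_image_split :
    N10.LowerHalf ↔ N10.LowerHalfRed ∧ N10.LowerHalfSurj ∧ N10.LowerHalfNonSurj := by
  constructor
  · intro h
    exact ⟨fun W _ _ p _ hr hL _ ↦ h W p hr hL, fun W _ _ p _ hr hL _ ↦ h W p hr hL,
      fun W _ _ p _ hr hL _ _ ↦ h W p hr hL⟩
  · intro h W _ _ p _ hr hL
    obtain ⟨hR, hS, hN⟩ := h
    by_cases hirr : Irr W p
    · by_cases hs : Surj W p
      · exact hS W p hr hL hs
      · exact hN W p hr hL hirr hs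
    · exact hR W p hr hL hirr

/-- **The reducible part of N10 ⟹ the X3 kernel LOWER conjunct** (`x3Sharp_iff_residues`, first
conjunct), binder for binder. [folklore] -/
theorem N10.x3KernelLower_of_lowerHalfRed (h : N10.LowerHalfRed) :
    ∀ (W : WeierstrassCurve ℚ) [W.IsElliptic] [W.IsGloballyMinimal] (p : ℕ) [Fact p.Prime],
      W.analyticRank = 0 → p ≠ 2 → ClassX3 W p → SubSemistableTwist W p →
      MissingLowerBoundAt W p := by
  intro W _ _ p _ hr hp2 hX hS
  have hc := N10.cellM_or_cellGordTwo_of_classX3_of_subSemistableTwist W p hp2 hX hS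
  have hL : N10.Locus W p := (N10.locus_iff_cells W p).mpr (hc.elim Or.inl (fun h2 ↦ Or.inr (Or.inl h2)))
  exact h W p hr hL hX.1

/-- **Conversely: the X3 kernel LOWER conjunct + the lower half on the reducible corner rows ⟹ the
reducible part of N10** — and the corner clause is implied by the tree's `X3SharpGordHigher`
(`N10.lowerHalfRed_corner_of_x3SharpGordHigher`). So on reducible rows `N10.LowerHalf` is EXACTLY
"X3 kernel LOWER ∧ corner". [folklore] -/
theorem N10.lowerHalfRed_of_x3KernelLower_of_corner
    (hK : ∀ (W : WeierstrassCurve ℚ) [W.IsElliptic] [W.IsGloballyMinimal] (p : ℕ) [Fact p.Prime],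
      W.analyticRank = 0 → p ≠ 2 → ClassX3 W p → SubSemistableTwist W p → MissingLowerBoundAt W p)
    (hC : ∀ (W : WeierstrassCurve ℚ) [W.IsElliptic] [W.IsGloballyMinimal] (p : ℕ) [Fact p.Prime],
      W.analyticRank = 0 → p ≠ 2 → ClassX3 W p → SubGordHigher W p → MissingLowerBoundAt W p) :
    N10.LowerHalfRed := by
  intro W _ _ p _ hr hL hred
  have hX : ClassX3 W p := ⟨hred, hL.2.1⟩
  rcases (N10.locus_iff_cells W p).mp hL with hc | hc | hc
  · exact hK W p hr hL.1 hX (N10.subSemistableTwist_of_cellM_or_cellGordTwo W p (Or.inl hc))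
  · exact hK W p hr hL.1 hX (N10.subSemistableTwist_of_cellM_or_cellGordTwo W p (Or.inr hc))
  · exact hC W p hr hL.1 hX (N10.subGordHigher_of_cellGordHigher W p hc)

/-- The tree's conjecture `X3SharpGordHigher` (both halves on the reducible corner, `r_an ≤ 1`) implies
the corner clause of `N10.lowerHalfRed_of_x3KernelLower_of_corner`. [folklore] -/
theorem N10.lowerHalfRed_corner_of_x3SharpGordHigher (h : X3SharpGordHigher) :
    ∀ (W : WeierstrassCurve ℚ) [W.IsElliptic] [W.IsGloballyMinimal] (p : ℕ) [Fact p.Prime],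
      W.analyticRank = 0 → p ≠ 2 → ClassX3 W p → SubGordHigher W p → MissingLowerBoundAt W p :=
  fun W _ _ p _ hr hp2 hX hS ↦
    (lower_and_upper_of_missingPPartAt W p (h W p (by rw [hr]; exact zero_le_one) hp2 hX hS)).1

/-- **The X4 kernel LOWER conjunct ⟹ the surjective part of N10** (`x4SharpUnitFree_iff_lower_and_residues_sharp`,
first conjunct, restricted to the potentially ORDINARY rows; its potentially supersingular rows are
O5/O6's). [folklore] -/
theorem N10.lowerHalfSurj_of_x4KernelLower
    (hK : ∀ (W : WeierstrassCurve ℚ) [W.IsElliptic] [W.IsGloballyMinimal] (p : ℕ) [Fact p.Prime],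
      W.analyticRank = 0 → ClassX4 W p → Surj W p → MissingLowerBoundAt W p) :
    N10.LowerHalfSurj := fun W _ _ p _ hr hL hs ↦
  hK W p hr ⟨hL.1, hL.2.1, hasIrreducibleModPGaloisRep_of_hasSurjectiveModNGaloisRep W p hs⟩ hs

/-- **X4♯(unit-free) ⟹ the surjective part of N10** (through the kernel's reduction of X4♯(unit-free)
to LOWER ∧ residues: its LOWER conjunct is a consequence of the conjecture itself, fact-free —
`MissingPPartAt → MissingLowerBoundAt`). [folklore] -/
theorem N10.lowerHalfSurj_of_x4SharpUnitFree (h : X4SharpUnitFree) : N10.LowerHalfSurj :=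
  N10.lowerHalfSurj_of_x4KernelLower fun W _ _ p _ hr hX hs ↦
    (lower_and_upper_of_missingPPartAt W p (h W p hr hX hs)).1

/-- **X3♯ ⟹ the reducible part of N10** (fact-free: X3♯ gives both halves on every odd X3 pair).
[folklore] -/
theorem N10.lowerHalfRed_of_x3Sharp (h : X3Sharp) : N10.LowerHalfRed := fun W _ _ p _ hr hL hred ↦
  (lower_and_upper_of_missingPPartAt W p
    (h W p (by rw [hr]; exact zero_le_one) hL.1 ⟨hred, hL.2.1⟩)).1

/-! ## §4 What the conjectures buy: `BSD(E,p)` on the N10 rows whose UPPER half is a kernel theorem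
(consumers of record, every published input an explicit named-fact binder; nothing new is proved about
elliptic curves here — these are the kernel's `…_of_lower` theorems fed with the conjecture) -/

section Consequences

variable (W : WeierstrassCurve ℚ) [W.IsElliptic] [W.IsGloballyMinimal] (p : ℕ) [hp : Fact p.Prime]

/-- **N10 ⟹ `BSD(E,p)` on X3 ∧ `r_an = 0` ∧ semistable twist ((M) ∪ (G-ord, `e = 2`)), every odd
`p`** — via the X3 end-state consumer `ClassX3.bsdp_rankZero_of_subSemistableTwist_of_lower` (four
named facts: Delbourgo 1998 Prop. 4 `hDel`, modular parametrisation data `hmodD`, Wuthrich 2014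
Thm. 16 half-eigen `hW16`, Wuthrich component `hWu`; + GZK `hGZK` + modularity `hmod`).
[cite: Delbourgo1998, Prop. 4 (p. 144)] [cite: Wuthrich2014, Thm. 16 (p. 397)] [cite: Miller2011LMS, §1 and Def. 1.1] -/
theorem N10.bsdp_rankZero_classX3_of_lowerHalf_of_subSemistableTwist (h : N10.LowerHalf)
    (hDel : Delbourgo1998.prop4_rankZero_pow_dvd_constantCoeff)
    (hGZK : rank_eq_analyticRank_of_analyticRank_le_one) (hmod : hasEntireLFunction_rat)
    (hmodD : nonempty_modularParametrizationData)
    (hW16 : Wuthrich2014.thm16_halfEigenCharIdeal_dvd_cyclotomicPrime)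
    (hWu : Wuthrich2014.charIdeal_dvd_padicLFunctionBranch_component)
    (hp2 : p ≠ 2) (hX : ClassX3 W p) (hr : W.analyticRank = 0) (hS : SubSemistableTwist W p) :
    BSDp W p :=
  ClassX3.bsdp_rankZero_of_subSemistableTwist_of_lower W p hDel hGZK hmod hmodD hW16 hWu hp2 hX hr hS
    (N10.x3KernelLower_of_lowerHalfRed ((N10.lowerHalf_iff_image_split.mp h).1) W p hr hp2 hX hS)

/-- **N10(M) ⟹ `BSD(E,p)` on X4(M) ∧ `r_an = 0` ∧ surj(p), every odd `p`** — via additive-p1's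
`ClassX4M.bsdp_rankZero_of_surj_of_lower` (Delbourgo Prop. 4 `hDel`, `hmodD`, Wuthrich Lemma 20
`hL20`, Kato's divisibility on the `ω^{(p−1)/2}`-component `hKato`; + GZK + modularity; NO Tamagawa,
NO Manin hypothesis). [cite: Delbourgo1998, Prop. 4 (p. 144)] [cite: Wuthrich2014, Lemma 20 (p. 399), Cor. 19 (p. 398)]
[cite: Miller2011LMS, §1 and Def. 1.1] -/
theorem N10.bsdp_rankZero_classX4M_of_lowerHalfM_of_surj (h : N10.LowerHalfM)
    (hDel : Delbourgo1998.prop4_rankZero_pow_dvd_constantCoeff)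
    (hGZK : rank_eq_analyticRank_of_analyticRank_le_one) (hmod : hasEntireLFunction_rat)
    (hmodD : nonempty_modularParametrizationData)
    (hL20 : Wuthrich2014.lemma20_surjective_threeAdic_of_semistable)
    (hKato : Wuthrich2014.kato_halfEigenCharIdeal_dvd_cyclotomicPrime_of_surjective)
    (hX : AdditivePotMult.ClassX4M W p) (hr : W.analyticRank = 0) (hsurj : Surj W p) : BSDp W p :=
  AdditivePotMult.ClassX4M.bsdp_rankZero_of_surj_of_lower hDel hGZK hmod hmodD hL20 hKato hX hr
    hsurj (h W p hr ((N10.cellM_iff_classX3M_or_classX4M W p).mpr (Or.inr hX)))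

/-- **N10(G-ord, `e = 2`) ⟹ `BSD(E,p)` on X4♯(G-ord) ∩ `I₀*` ∧ `r_an = 0` ∧ surj(p)** (with a (ram)
witness at `p = 3` for the tower) — via additive-p2's `ClassX4Gord.bsdp_rankZero_of_katoComponent_of_lower`
(Kato component reading `hK`, Delbourgo Prop. 4 `hDel`, `hmodD`; + GZK + modularity; NO Tamagawa, NO
Manin hypothesis). [cite: Kato2004Asterisque, Thm. 17.4 (3) (p. 273)] [cite: Delbourgo1998, Prop. 4 (p. 144)]
[cite: Miller2011LMS, §1 and Def. 1.1] -/
theorem N10.bsdp_rankZero_classX4GordTwo_of_lowerHalfGordTwo_of_surj (h : N10.LowerHalfGordTwo)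
    (hK : Kato2004.charIdeal_dvd_padicLFunctionBranch_component_of_surjective)
    (hDel : Delbourgo1998.prop4_rankZero_pow_dvd_constantCoeff)
    (hGZK : rank_eq_analyticRank_of_analyticRank_le_one) (hmod : hasEntireLFunction_rat)
    (hmodD : nonempty_modularParametrizationData)
    (hX : ClassX4Gord W p) (he : semistabilityIndex W p = 2) (hr : W.analyticRank = 0)
    (hsurj : Surj W p) (hram3 : p = 3 → Ram W p) : BSDp W p :=
  ClassX4Gord.bsdp_rankZero_of_katoComponent_of_lower hK hDel hGZK hmod hmodD hX he hr hsurj hram3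
    (h W p hr ⟨hX.1.1, hX.1.2.1, hX.2, he⟩)

/-- **N10 ⟹ `BSD(E,p)` on the whole COVERED LOCUS of X4 ∧ `r_an = 0` ∧ surj(p) ∧ potentially ordinary,
every odd `p`** — via additive-p4's chain of record `X4RankZero.bsdp_of_facts_of_lower` (covered locus
= `ord_p j < 0` ∨ (tower ∧ `ord_p ∏ c_ℓ = ord_p c_p` ∧ Manin datum); five named facts `hKatoS`,
`hDel`, `hmodD`, `hL20`, `hKatoχ`; + GZK + modularity). This covers the higher-defect corner's
X4 ∧ surj rows (at `p ≥ 5` the tower is automatic by Serre). FLAG (referee-1 ACK-1 T-N10 proviso,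
verbatim): the binder `hKatoS` is the READING-FACT A161
`Kato2004.rankZero_padicValNat_sha_le_sub_localTamagawa_of_additive_potGood_of_imageContainsSL2`,
flag `Kato-14.5(3)-14.16(2)-additive-potgood-reading-sharp` (Kato 2004 Thm. 14.5 (3) + Prop. 14.16 (2)
additive potentially-good SHARP reading; ADMITTED at statement level, R122 §C (b) / tier D R125.2;
formal D-closure owed): on the potentially GOOD branch of the covered locus the upper half, hence
`BSD(E,p)` here, is obtained MODULO this reading-fact — it is carried as an explicit hypothesis, never
as a `_holds`. [cite: Kato2004Asterisque, Thm. 14.5 (3) (p. 236), Prop. 14.16 (2) (p. 244)]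
[cite: Delbourgo1998, Prop. 4 (p. 144)] [cite: Miller2011LMS, §1 and Def. 1.1] -/
theorem N10.bsdp_rankZero_classX4_covered_of_lowerHalf (h : N10.LowerHalf)
    (hKatoS : Kato2004.rankZero_padicValNat_sha_le_sub_localTamagawa_of_additive_potGood_of_imageContainsSL2)
    (hDel : Delbourgo1998.prop4_rankZero_pow_dvd_constantCoeff)
    (hGZK : rank_eq_analyticRank_of_analyticRank_le_one) (hmod : hasEntireLFunction_rat)
    (hmodD : nonempty_modularParametrizationData)
    (hL20 : Wuthrich2014.lemma20_surjective_threeAdic_of_semistable)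
    (hKatoχ : Wuthrich2014.kato_halfEigenCharIdeal_dvd_cyclotomicPrime_of_surjective)
    (hr : W.analyticRank = 0) (hX : ClassX4 W p) (hsurj : Surj W p)
    (hord : PotMult W p ∨ TypeGOrd W p)
    (hcov : padicValRat p W.j < 0 ∨
      ((∀ n : ℕ, W.HasSurjectiveModNGaloisRep (p ^ n : ℕ)) ∧
        padicValNat p W.tamagawaProduct =
          padicValNat p ((W.baseChange ℚ_[p]).localTamagawaNumber ℤ_[p]) ∧
        ∃ (N : ℕ) (_ : NeZero N) (D : ModularParametrizationData W N), ¬ (p : ℤ) ∣ D.maninConstant)) :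
    BSDp W p :=
  X4RankZero.bsdp_of_facts_of_lower W p hKatoS hDel hGZK hmod hmodD hL20 hKatoχ hr hX hsurj hcov
    (h W p hr ⟨hX.1, hX.2.1, hord⟩)

end Consequences

end Summit.BirchSwinnertonDyer.Rank1Residual.Additive

end
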